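import Summits.ABC.IUTFork.Thm311RealIsmDHUnramified
import HarnessLib

/-!
# [IUTchIII] Cor. 3.12, TEAM R: at a place of local degree `1` (`K_v = ℚ_p`, ANY `p`, including `p = 2`) every
# element of Dupuy–Hilado's (Ind2) family `Real.ismDH` is an isometry — the `F = ℚ` case in full

PROOF-ONLY file (abc-iut cell, WAVE-5 seat abc-iut-w5-d216 gen 2; TEAM R indFixes thread, lead R1 =
abc-iut-c312-14); TAKES NO SIDE on [IUTchIII] Cor. 3.12.  Classical.

Sequel of p428821 (`Thm311RealIsmDHUnramified`: unramified places of ODD residue characteristic, any residue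
degree).  Here the residue characteristic is arbitrary but the local degree is `n_v = e·f = 1`, i.e. `K_v ≅ ℚ_p` —
EVERY finite place of `F = ℚ`, the base field of the pilot datum of record.  Then a bicontinuous `ℚ`-linear `φ`
is `ℚ_p`-linear (p428821 `IsmDHUnram.map_smul_of_continuous`), hence `φ(y) = y·φ(1)` and `‖φ y‖ = ‖y‖·‖φ 1‖`; and
`φ(I_v) = I_v` with `I_v` COMPACT (abc-iut-L4 `isCompact_logShell_ofUnitLog`) and `∋ 1` (`𝒪_v ⊆ I_v`,
`integers_subset_shell_analyticLogv`) forces `‖φ 1‖ = 1` (compare the maximum of `‖·‖` on `I_v` with its image).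
No shell formula beyond compactness is used, so `p = 2` is included.

Decls: `norm_of_map_eq_of_mem_ismDH_of_localDeg_eq_one` (rescaled norm), `norm_map_eq_of_mem_ismDH_of_localDeg_eq_one`
(norm of `K_v`), `ismDH_image_closedBall_of_localDeg_eq_one` (every ball centred `0` onto itself).  Axioms: standard.
-/

noncomputable section

open Metric Set Function
open scoped Pointwise

namespace Summit.ABC.IUTFork.Thm311.Real

open Literature.IUT.LogVolume Literature.NumberTheory.NumberFields
open Literature.NumberTheory.GaloisRepresentations.Ultrametric
open Literature.AnabelianGeometry.AbsoluteAnabelian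
open Literature.IUT.LogThetaLattice (isCompact_logShell_ofUnitLog)
open NumberField IsDedekindDomain

section Instance

variable {F : Type} [Field F] [NumberField F] (p : ℕ) [Fact p.Prime] (v : HeightOneSpectrum (𝓞 F))
  (hv : ((p : ℕ) : 𝓞 F) ∈ v.asIdeal)

/-- **At a place of local degree `1` every element of DH's (Ind2) family is an isometry of the rescaled
completion** (any residue characteristic): `‖φ x‖ = ‖x‖` in `K_v^{(1/n_v)} = K_v ≅ ℚ_p` for
`φ ∈ Real.ismDH (analyticLogv F) v`. [cite: DupuyHilado2025, §4.9] -/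
theorem norm_of_map_eq_of_mem_ismDH_of_localDeg_eq_one (hp : residueChar F v = p) (hdeg : localDeg F v = 1)
    {φ : Carrier (.inr v : Place F) ≃ₗ[ℚ] Carrier (.inr v : Place F)}
    (hφ : φ ∈ ismDH (analyticLogv F) (.inr v : Place F)) (x : Carrier (.inr v : Place F)) :
    ‖RescaledCompletion.of F p v hv (φ x)‖ = ‖RescaledCompletion.of F p v hv x‖ := by
  subst hp
  set K := RescaledCompletion F (residueChar F v) v hv
  let e : Carrier (.inr v : Place F) ≃+* K := RescaledCompletion.of F (residueChar F v) v hv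
  obtain ⟨hc, -, himg⟩ := hφ
  -- `φ` read on `K`
  let f : K →+ K := (e.symm.toAddEquiv.trans (φ.toAddEquiv.trans e.toAddEquiv)).toAddMonoidHom
  have hfc : Continuous f := hc
  -- `K` is a line over `ℚ_p`: `φ(y) = y·φ(1)` in norm
  have hfin : Module.finrank ℚ_[residueChar F v] K = 1 :=
    (RescaledCompletion.localDeg_eq_finrank F (residueChar F v) v hv).symm.trans hdeg
  have hspan : ∀ y : K, ∃ c : ℚ_[residueChar F v], c • (1 : K) = y :=
    (finrank_eq_one_iff_of_nonzero' (1 : K) one_ne_zero).mp hfin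
  have hnorm : ∀ y : K, ‖f y‖ = ‖y‖ * ‖f 1‖ := by
    intro y
    obtain ⟨c, rfl⟩ := hspan y
    rw [IsmDHUnram.map_smul_of_continuous f hfc, norm_smul, norm_smul, norm_one, mul_one]
  -- the shell, read on `K`, is compact, contains `1`, and is mapped onto itself
  have hshell : shell (analyticLogv F) (.inr v) =
      e.symm '' logShell (PadicLogOnUnits.ofUnitLog (residueChar F v) K) :=
    shell_eq_image_logShell_of_formula (residueChar F v) v hv (analyticLogv F) rfl
      (fun u => analyticLogv_apply F v u)
  set B : Set K := logShell (PadicLogOnUnits.ofUnitLog (residueChar F v) K) with hBdef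
  have hB : f '' B = B := by
    have h1 : f '' B = e '' (⇑φ '' (e.symm '' B)) := by
      rw [Set.image_image, Set.image_image]
      rfl
    rw [h1, ← hshell, himg, hshell, Set.image_image]
    simp only [RingEquiv.apply_symm_apply, Set.image_id']
  have hBc : IsCompact B := isCompact_logShell_ofUnitLog (residueChar F v) K
  have h1B : (1 : K) ∈ B := by
    have h1 : (1 : Carrier (.inr v : Place F)) ∈ shell (analyticLogv F) (.inr v) :=
      integers_subset_shell_analyticLogv (F := F) v (integers v).one_mem
    rw [hshell] at h1
    obtain ⟨b, hb, hb1⟩ := h1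
    have hb' : b = 1 := by rw [← e.apply_symm_apply b, hb1, map_one]
    exact hb' ▸ hb
  -- the maximum of the norm on `B` is positive and preserved: `‖f 1‖ = 1`
  obtain ⟨z₀, hz₀, hmax⟩ := hBc.exists_isMaxOn ⟨1, h1B⟩ continuous_norm.continuousOn
  have hmax' : ∀ z ∈ B, ‖z‖ ≤ ‖z₀‖ := fun z hz => hmax hz
  have hM : 0 < ‖z₀‖ := lt_of_lt_of_le (by rw [norm_one]; exact one_pos) (hmax' 1 h1B)
  have hle : ‖f 1‖ ≤ 1 := by
    have hfz : f z₀ ∈ B := by rw [← hB]; exact Set.mem_image_of_mem f hz₀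
    have h := hmax' _ hfz
    rw [hnorm z₀] at h
    exact (mul_le_iff_le_one_right hM).mp h
  have hge : 1 ≤ ‖f 1‖ := by
    have hz : z₀ ∈ f '' B := by rw [hB]; exact hz₀
    obtain ⟨z₁, hz₁, hz₁₀⟩ := hz
    have h := hmax' _ hz₁
    have h' : ‖z₀‖ = ‖z₁‖ * ‖f 1‖ := by rw [← hz₁₀, hnorm z₁]
    by_contra hlt
    rw [not_le] at hlt
    have : ‖z₁‖ * ‖f 1‖ < ‖z₀‖ * 1 :=
      mul_lt_mul' h hlt (norm_nonneg _) hM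
    rw [mul_one, ← h'] at this
    exact lt_irrefl _ this
  have hf1 : ‖f 1‖ = 1 := le_antisymm hle hge
  show ‖f (e x)‖ = ‖e x‖
  rw [hnorm, hf1, mul_one]

/-- The same in the norm `|·|_v` of `K_v`. [cite: DupuyHilado2025, §4.9] -/
theorem norm_map_eq_of_mem_ismDH_of_localDeg_eq_one (hp : residueChar F v = p) (hdeg : localDeg F v = 1)
    {φ : Carrier (.inr v : Place F) ≃ₗ[ℚ] Carrier (.inr v : Place F)}
    (hφ : φ ∈ ismDH (analyticLogv F) (.inr v : Place F)) (x : Carrier (.inr v : Place F)) :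
    ‖φ x‖ = ‖x‖ := by
  have hv' : ((p : ℕ) : 𝓞 F) ∈ v.asIdeal := hp ▸ natCast_residueChar_mem F v
  have h1 : ‖φ x‖ = ‖RescaledCompletion.of F p v hv' (φ x)‖ ^ localDeg F v :=
    RescaledCompletion.norm_eq_norm_of_pow F p v hv' (φ x)
  have h2 : ‖x‖ = ‖RescaledCompletion.of F p v hv' x‖ ^ localDeg F v :=
    RescaledCompletion.norm_eq_norm_of_pow F p v hv' x
  rw [h1, h2, norm_of_map_eq_of_mem_ismDH_of_localDeg_eq_one p v hv' hp hdeg hφ x]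

/-- **Every closed ball of `K_v` centred at `0` is mapped onto itself by every element of DH's (Ind2) family at a
place of local degree `1`** — at EVERY finite place when `F = ℚ`. [cite: DupuyHilado2025, §4.9] -/
theorem ismDH_image_closedBall_of_localDeg_eq_one (hp : residueChar F v = p) (hdeg : localDeg F v = 1)
    {φ : Carrier (.inr v : Place F) ≃ₗ[ℚ] Carrier (.inr v : Place F)}
    (hφ : φ ∈ ismDH (analyticLogv F) (.inr v : Place F)) (r : ℝ) :
    ⇑φ '' closedBall (0 : Carrier (.inr v : Place F)) r = closedBall 0 r := by
  ext y
  simp only [Set.mem_image, mem_closedBall_zero_iff]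
  constructor
  · rintro ⟨x, hx, rfl⟩
    rwa [norm_map_eq_of_mem_ismDH_of_localDeg_eq_one p v hp hdeg hφ x]
  · intro hy
    refine ⟨φ.symm y, ?_, φ.apply_symm_apply y⟩
    rw [← norm_map_eq_of_mem_ismDH_of_localDeg_eq_one p v hp hdeg hφ (φ.symm y), φ.apply_symm_apply]
    exact hy

end Instance

end Summit.ABC.IUTFork.Thm311.Real
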